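/-
COR-CM (cell pub-hodgecm2, stage 2 of the Hodge ladder) — count-neutral kernel combinatorics (seat prover-pub-hodgecm2-b23-g53-0, binder
prover b23, gen 53; lane SYLOW TRANSFER XIII «the order-8p assembly», blanket `Census/SylowTransfer*` HOME/INBOX.md l.23357, claim l.24246).
Theorems only, in seat b09's intrinsic model (consumed BY NAME, nothing restated); no definition, no certificate, no `decide`, no named fact, no
geometry, no `sorry`.  `Interfaces.lean` (C1), every E term, B01 and `Transposition/*` are untouched.
HONEST FRAMING: `HC_CM` is NOT proved, here or anywhere in the tree; nothing here is a period or a headline.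
-/
import Summits.HodgeConjecture.CorCM.Census.SylowTransferEightPrimePower
import Summits.HodgeConjecture.CorCM.Census.SylowTransferSquare
import Summits.HodgeConjecture.CorCM.Census.ShearedDihedralLaw

/-!
# Sylow transfer, XIII: non-abelian Sylow `2`-subgroups of order `8` and the sheared datum from elements

Gen 51ʼs parts VII/IX and gen 52ʼs part XII settle every group of order `8pᵏ` (`p` an odd prime) with an ABELIAN Sylow `2`-subgroup or with an
element of order `4pᵏ`; gen 52ʼs sheared dihedral law (`Census/ShearedDihedralLaw.lean`) settles `X_n = ℤ/n ⋊ D₄` with the Klein kernel.  This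
file assembles them over a NORMAL cyclic odd part:
* §1 bookkeeping in a NON-ABELIAN subgroup `P` of order `8`: for `y ∈ P` of order `4` every `x ∈ P ∖ ⟨y⟩` inverts `y` and has `x² ∈ {1, y²}`
  (`conj_eq_inv_and_sq_of_card_eight_not_comm`); hence every square in `P` is `1` or `y²` (`sq_eq_one_or_eq_sq_of_card_eight_not_comm`).
* §2 **THE SHEARED DATUM FROM ELEMENTS** (`isLeast_card_gfaces_generate_fibreTwo_of_sheared_elements`): `|G| = 8n` (`n ≥ 3` odd), `z` of order
  `n`, `y² = c`, `y` inverts `z`, an involution `s` centralising `z` and inverting `y` ⟹ `(g, s, x) := (c·z, s, y·s)` is a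
  `ShearedDihedral.Datum G c n` ⟹ **`μ(G, c) = φ₂(G, c)`** (gen 52ʼs law BY NAME).
* §3 **THE LAW FOR A NORMAL CYCLIC ODD PART OF PRIME-POWER ORDER** (`isLeast_card_gfaces_generate_fibreTwo_of_normal_zpowers_prime_pow`):
  `|G| = 8pᵏ` (`p` an odd prime, `k ≥ 1`), `z` of order `pᵏ` with `⟨z⟩` normal, `c ≠ 1` a central involution ⟹ **`μ(G, c) = φ₂(G, c)`**.
  DISPATCH over a Sylow `2`-subgroup `P ∋ c`: `P` abelian ⟹ part VII; else `y ∈ P` with `y² = c` (part XI), every square of `P` lies in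
  `{1, c}` so every `w ∈ P` centralises or inverts `z` (square roots of `1` modulo `pᵏ`, part XII); an element of order `4` of `P` centralising
  `z` gives an element of order `4pᵏ` (part XII); otherwise `y` inverts `z` and an involution `s ∈ P ∖ ⟨y⟩` centralises `z` (§2).
  Order `24`: every group with a normal subgroup of order `3` — everything but `SL(2,3)` (`…_of_card_eq_twentyfour_of_normal`).
Part XIV (`Census/SylowTransferEightPrimeAll.lean`) removes the normality hypothesis for `p ≥ 5` by Sylow counting.
All [folklore] bookkeeping over [Pohlmann1968, Thm 1] in the reading of [Milne1999, Prop. 2.1].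

## References
* [Pohlmann1968] H. Pohlmann, Algebraic cycles on abelian varieties of complex multiplication type, Ann. of Math. 88 (1968), Thm 1.
* [Milne1999] J. S. Milne, Lefschetz motives and the Tate conjecture, Compositio Math. 117 (1999), Prop. 2.1, p. 54.
-/

namespace Summit.HodgeConjecture.CorCM.Census.SylowTransfer

open Finset
open Summit.HodgeConjecture.CorCM.Prior.AllgGroup.RfwfAllgGroup
open Summit.HodgeConjecture.CorCM.Census.BlockParity
open Summit.HodgeConjecture.CorCM.Census.Coinvariant

noncomputable section

section Group

variable {G : Type*} [Group G]

/-! ## §1 Non-abelian subgroups of order `8` -/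

/-- In a subgroup `P` of order `8`, the cyclic subgroup `⟨y⟩` of an element `y ∈ P` of order `4` has index two in `P`: it is normal in `P`,
contains every square of `P`, and `P = ⟨y⟩ ∪ x⟨y⟩` for any `x ∈ P ∖ ⟨y⟩`. [folklore] -/
theorem conj_mem_zpowers_of_card_eight [Finite G] {P : Subgroup G} (hP : Nat.card P = 8) {y x : G} (hy : y ∈ P) (hx : x ∈ P)
    (hord : orderOf y = 4) (hxy : x ∉ Subgroup.zpowers y) :
    x * y * x⁻¹ ∈ Subgroup.zpowers y ∧ x * x ∈ Subgroup.zpowers y ∧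
      ∀ a ∈ P, a ∈ Subgroup.zpowers y ∨ x⁻¹ * a ∈ Subgroup.zpowers y := by
  set y' : P := ⟨y, hy⟩ with hy'
  set x' : P := ⟨x, hx⟩ with hx'
  set K : Subgroup P := Subgroup.zpowers y' with hK
  have hordy' : orderOf y' = 4 := by rw [hy', Subgroup.orderOf_mk, hord]
  have hKcard : Nat.card K = 4 := by rw [hK, Nat.card_zpowers, hordy']
  have hidx : K.index = 2 := by
    have h := K.card_mul_index
    rw [hKcard, hP] at h
    omega
  haveI hKn : K.Normal := Subgroup.normal_of_index_eq_two hidx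
  -- transport of membership
  have hmem : ∀ (a : G) (ha : a ∈ P), (⟨a, ha⟩ : P) ∈ K ↔ a ∈ Subgroup.zpowers y := fun a ha => by
    constructor
    · intro h
      obtain ⟨i, hi⟩ := Subgroup.mem_zpowers_iff.mp h
      refine Subgroup.mem_zpowers_iff.mpr ⟨i, ?_⟩
      have := congrArg Subtype.val hi
      simpa using this
    · intro h
      obtain ⟨i, hi⟩ := Subgroup.mem_zpowers_iff.mp h
      refine Subgroup.mem_zpowers_iff.mpr ⟨i, Subtype.ext ?_⟩
      simpa using hi
  have hx'K : x' ∉ K := fun h => hxy ((hmem x hx).mp h)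
  refine ⟨?_, ?_, fun a ha => ?_⟩
  · have h1 : x' * y' * x'⁻¹ ∈ K := hKn.conj_mem y' (Subgroup.mem_zpowers y') x'
    exact (hmem _ (mul_mem (mul_mem hx hy) (inv_mem hx))).mp h1
  · have h2 : x' * x' ∈ K := Subgroup.mul_self_mem_of_index_two hidx x'
    exact (hmem _ (mul_mem hx hx)).mp h2
  · by_cases haK : (⟨a, ha⟩ : P) ∈ K
    · exact Or.inl ((hmem a ha).mp haK)
    · right
      have h3 : x'⁻¹ * ⟨a, ha⟩ ∈ K :=
        (Subgroup.mul_mem_iff_of_index_two hidx).mpr ⟨fun h => absurd (inv_mem_iff.mp h) hx'K, fun h => absurd h haK⟩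
      exact (hmem _ (mul_mem (inv_mem hx) ha)).mp h3

/-- **NON-ABELIAN ORDER `8`**: for `y ∈ P` of order `4` every `x ∈ P ∖ ⟨y⟩` inverts `y` (`x y x⁻¹ = y⁻¹`) and has `x² ∈ {1, y²}`
(`P ∈ {D₄, Q₈}`; no classification used). [folklore] -/
theorem conj_eq_inv_and_sq_of_card_eight_not_comm [Finite G] {P : Subgroup G} (hP : Nat.card P = 8)
    (hnc : ¬ ∀ a ∈ P, ∀ b ∈ P, a * b = b * a) {y x : G} (hy : y ∈ P) (hx : x ∈ P) (hord : orderOf y = 4)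
    (hxy : x ∉ Subgroup.zpowers y) : x * y * x⁻¹ = y⁻¹ ∧ (x * x = 1 ∨ x * x = y ^ 2) := by
  obtain ⟨hconj, hsq, hsplit⟩ := conj_mem_zpowers_of_card_eight hP hy hx hord hxy
  have hconj4 : orderOf (x * y * x⁻¹) = 4 := by rw [← MulAut.conj_apply, MulEquiv.orderOf_eq, hord]
  have hinv : x * y * x⁻¹ = y⁻¹ := by
    rcases eq_or_eq_inv_of_orderOf_four hord hconj hconj4 with h | h
    · -- `x` commutes with `y`: then `P = ⟨y⟩ ∪ x⟨y⟩` is abelian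
      exfalso
      have hc : Commute x y := mul_inv_eq_iff_eq_mul.mp h
      apply hnc
      have hct : ∀ a ∈ P, Commute a y ∧ Commute a x := fun a ha => by
        rcases hsplit a ha with h | h
        · obtain ⟨i, rfl⟩ := Subgroup.mem_zpowers_iff.mp h
          exact ⟨Commute.zpow_left (Commute.refl y) i, (hc.symm).zpow_left i⟩
        · obtain ⟨i, hi⟩ := Subgroup.mem_zpowers_iff.mp h
          have ha' : a = x * y ^ i := by rw [hi, mul_inv_cancel_left]
          rw [ha']
          exact ⟨hc.mul_left (Commute.zpow_left (Commute.refl y) i), (Commute.refl x).mul_left ((hc.symm).zpow_left i)⟩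
      intro a ha b hb
      obtain ⟨hay, hax⟩ := hct a ha
      rcases hsplit b hb with h | h
      · obtain ⟨i, rfl⟩ := Subgroup.mem_zpowers_iff.mp h
        exact (hay.zpow_right i).eq
      · obtain ⟨i, hi⟩ := Subgroup.mem_zpowers_iff.mp h
        have hb' : b = x * y ^ i := by rw [hi, mul_inv_cancel_left]
        rw [hb']
        exact (hax.mul_right (hay.zpow_right i)).eq
    · exact h
  exact ⟨hinv, eq_one_or_eq_sq_of_inverted hord hinv hsq (by group)⟩

/-- **Every square in a non-abelian subgroup of order `8` is `1` or `y²`** (`y ∈ P` of order `4`; `y²` is the central involution of `P`).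
[folklore] -/
theorem sq_eq_one_or_eq_sq_of_card_eight_not_comm [Finite G] {P : Subgroup G} (hP : Nat.card P = 8)
    (hnc : ¬ ∀ a ∈ P, ∀ b ∈ P, a * b = b * a) {y : G} (hy : y ∈ P) (hord : orderOf y = 4) {w : G} (hw : w ∈ P) :
    w * w = 1 ∨ w * w = y ^ 2 := by
  by_cases hwy : w ∈ Subgroup.zpowers y
  · obtain ⟨i, hi, rfl⟩ := IndexTwoCyclic.exists_pow_eq_of_mem_zpowers hwy
    rw [hord] at hi
    have h4 : y ^ 4 = 1 := by rw [← hord, pow_orderOf_eq_one]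
    interval_cases i
    · left; rw [pow_zero, mul_one]
    · right; rw [pow_one, pow_two]
    · left; rw [← pow_add, h4]
    · right; rw [← pow_add, show 3 + 3 = 4 + 2 by norm_num, pow_add, h4, one_mul]
  · exact (conj_eq_inv_and_sq_of_card_eight_not_comm hP hnc hy hw hord hwy).2

/-- An element of order `4` outside the cyclic subgroup of another element of order `4` exists in a subgroup of order `8`:
`P ⊄ ⟨y⟩`. [folklore] -/
theorem exists_notMem_zpowers_of_card_eight [Finite G] {P : Subgroup G} (hP : Nat.card P = 8) {y : G} (hord : orderOf y = 4) :
    ∃ x ∈ P, x ∉ Subgroup.zpowers y := by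
  by_contra h
  push Not at h
  have hle : P ≤ Subgroup.zpowers y := fun a ha => h a ha
  have := Subgroup.card_le_of_le hle
  rw [hP, Nat.card_zpowers, hord] at this
  omega

/-- **The conjugation dichotomy from a central square**: if `w z w⁻¹ ∈ ⟨z⟩`, `ord z = pᵏ` (`p` an odd prime) and `w²` centralises `z`, then
`w z w⁻¹ = z` or `z⁻¹` (part XII: a square root of `1` modulo `pᵏ` is `±1`). [folklore] -/
theorem conj_eq_or_eq_inv_of_sq_centralises [Finite G] {z w : G} {p k : ℕ} (hp : p.Prime) (hp2 : p ≠ 2) (hz : orderOf z = p ^ k)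
    (hwz : w * z * w⁻¹ ∈ Subgroup.zpowers z) (hw2 : w * w * z * (w * w)⁻¹ = z) :
    w * z * w⁻¹ = z ∨ w * z * w⁻¹ = z⁻¹ := by
  obtain ⟨s, -, hs⟩ := IndexTwoCyclic.exists_pow_eq_of_mem_zpowers hwz
  have h1 : w * z ^ s * w⁻¹ = (z ^ s) ^ s := by
    rw [← MulAut.conj_apply, map_pow, MulAut.conj_apply, hs]
  have h2 : w * (w * z * w⁻¹) * w⁻¹ = z := by
    rw [show w * (w * z * w⁻¹) * w⁻¹ = w * w * z * (w * w)⁻¹ by group]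
    exact hw2
  rw [← hs] at h2
  rw [h1] at h2
  rw [← hs]
  exact pow_eq_or_eq_inv_of_sq_prime_pow hp hp2 hz h2

end Group

variable {G : Type*} [Group G] [Fintype G] [DecidableEq G]

/-! ## §2 The sheared datum from elements -/

/-- **THE SHEARED DATUM FROM ELEMENTS ⟹ `μ(G, c) = φ₂(G, c)`**: `|G| = 8n` (`n ≥ 3` odd), `z` of order `n`, `y² = c`, `y z y⁻¹ = z⁻¹`, an
involution `s` commuting with `z` and inverting `y` — then `(c·z, s, y·s)` is a sheared dihedral datum at level `n` (gen 52, part I) and gen 52ʼs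
sheared dihedral law applies. [folklore] -/
theorem isLeast_card_gfaces_generate_fibreTwo_of_sheared_elements (c : G) {n : ℕ} (hn : Odd n) (h3 : 3 ≤ n)
    (hG : Fintype.card G = 8 * n) (z y s : G) (hz : orderOf z = n) (hyy : y * y = c) (hyz : y * z * y⁻¹ = z⁻¹)
    (hs2 : s * s = 1) (hsz : s * z = z * s) (hsy : s * y * s⁻¹ = y⁻¹)
    (hc2 : c * c = 1) (hc1 : c ≠ 1) (hcen : ∀ w : G, w * c = c * w) :
    IsLeast {m : ℕ | ∃ S : Finset (CMF G c →₀ ℤ), (↑S ⊆ gfaceSet G c hc2) ∧ S.card = m ∧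
      hodgeSpan c hc2 ≤ Submodule.span ℤ (pairSet c) ⊔ Submodule.span ℤ (translates c S)} (fibreTwo c hc2) := by
  haveI : Fact (Nat.Prime 2) := ⟨Nat.prime_two⟩
  have hordc : orderOf c = 2 := orderOf_eq_prime (by rw [pow_two, hc2]) hc1
  have hcz : Commute c z := (hcen z).symm
  have hcs : Commute c s := (hcen s).symm
  have hsinv : s⁻¹ = s := inv_eq_of_mul_eq_one_right hs2
  have hcinv : c⁻¹ = c := inv_eq_of_mul_eq_one_right hc2
  have hzn : z ^ n = 1 := by rw [← hz, pow_orderOf_eq_one]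
  -- `c^n = c`
  have hcn : c ^ n = c := by
    obtain ⟨m, rfl⟩ := hn
    rw [pow_succ, pow_mul, pow_two, hc2, one_pow, one_mul]
  -- `y ≠ y⁻¹`
  have hyne : y ≠ y⁻¹ := fun h => hc1 (by rw [← hyy]; nth_rewrite 1 [h]; exact inv_mul_cancel y)
  -- the datum fields
  have hgn : (c * z) ^ n = c := by rw [hcz.mul_pow, hzn, mul_one, hcn]
  have hord : orderOf (c * z) = 2 * n := by
    rw [hcz.orderOf_mul_eq_mul_orderOf_of_coprime (by rw [hordc, hz]; exact Nat.coprime_two_left.mpr hn), hordc, hz]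
  have hgs : c * z * s = s * (c * z) := by
    calc c * z * s = c * (z * s) := mul_assoc _ _ _
      _ = c * (s * z) := by rw [hsz]
      _ = (c * s) * z := (mul_assoc _ _ _).symm
      _ = (s * c) * z := by rw [hcs.eq]
      _ = s * (c * z) := mul_assoc _ _ _
  have hgs' : Commute (c * z) s := hgs
  have hs : s ∉ Subgroup.zpowers (c * z) := by
    intro hmem
    by_cases hs1 : s = 1
    · apply hyne
      have := hsy
      rw [hs1, one_mul, inv_one, mul_one] at this
      exact this
    · have hsc : s = (c * z) ^ n := IndexTwoCyclic.eq_pow_of_mem_zpowers_of_mul_self hord hmem hs2 hs1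
      rw [hgn] at hsc
      apply hyne
      have := hsy
      rw [hsc, hcinv, ← hcen y, mul_assoc, hc2, mul_one] at this
      exact this
  have hx2 : y * s * (y * s) = 1 := by
    calc y * s * (y * s) = y * (s * y * s⁻¹) := by rw [hsinv]; group
      _ = 1 := by rw [hsy, mul_inv_cancel]
  have hyzy : y * z * y⁻¹ = z⁻¹ := hyz
  have hxg : y * s * (c * z) * (y * s)⁻¹ = (c * z)⁻¹ := by
    calc y * s * (c * z) * (y * s)⁻¹ = y * (s * (c * z) * s⁻¹) * y⁻¹ := by group
      _ = y * (c * z) * y⁻¹ := by rw [← hgs, mul_inv_cancel_right]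
      _ = (y * c) * (z * y⁻¹) := by group
      _ = (c * y) * (z * y⁻¹) := by rw [hcen y]
      _ = c * (y * z * y⁻¹) := by group
      _ = c * z⁻¹ := by rw [hyzy]
      _ = (c * z)⁻¹ := by rw [mul_inv_rev, hcinv, hcz.inv_right.eq]
  have hysy : y * s * y⁻¹ = c * s := by
    -- from `s y s⁻¹ = y⁻¹`: `y = s y⁻¹ s`, so `y s y⁻¹ = s y⁻¹ (s s) y⁻¹ = s (y y)⁻¹ = s c`
    have hy : y = s * y⁻¹ * s := by
      calc y = s⁻¹ * (s * y * s⁻¹) * s := by group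
        _ = s⁻¹ * y⁻¹ * s := by rw [hsy]
        _ = s * y⁻¹ * s := by rw [hsinv]
    calc y * s * y⁻¹ = (s * y⁻¹ * s) * s * y⁻¹ := by rw [← hy]
      _ = s * y⁻¹ * (s * s) * y⁻¹ := by group
      _ = s * (y * y)⁻¹ := by rw [hs2]; group
      _ = c * s := by rw [hyy, hcinv, hcs.eq]
  have hxs : y * s * s * (y * s)⁻¹ = (c * z) ^ n * s := by
    rw [hgn]
    calc y * s * s * (y * s)⁻¹ = y * (s * s) * s⁻¹ * y⁻¹ := by group
      _ = y * s * y⁻¹ := by rw [hs2, mul_one, hsinv]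
      _ = c * s := hysy
  have hx : ∀ i j : ℕ, y * s ≠ (c * z) ^ i * s ^ j := by
    intro i j h
    apply hyne
    have hy : y = (c * z) ^ i * s ^ j * s⁻¹ := by rw [← h, mul_inv_cancel_right]
    have hcomm : s * y * s⁻¹ = y := by
      rw [hy]
      have h1 : Commute s ((c * z) ^ i) := (hgs'.symm).pow_right i
      have h2 : Commute s (s ^ j) := (Commute.refl s).pow_right j
      rw [((h1.mul_right h2).mul_right (Commute.refl s).inv_right).eq, mul_inv_cancel_right]
    rw [hcomm] at hsy
    exact hsy
  have hcard : Nat.card G = 8 * n := by rw [Nat.card_eq_fintype_card, hG]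
  let D : ShearedDihedral.Datum G c n :=
    { g := c * z, s := s, x := y * s, hgn := hgn, hord := hord, hs2 := hs2, hgs := hgs, hs := hs, hx2 := hx2, hxg := hxg,
      hxs := hxs, hx := hx, hcard := hcard }
  exact D.isLeast_card_gfaces_generate hn h3 hc2

/-! ## §3 The law for a normal cyclic odd part of prime-power order -/

/-- **ORDER `8pᵏ` (`p` AN ODD PRIME, `k ≥ 1`), `z` OF ORDER `pᵏ` WITH `⟨z⟩` NORMAL, EVERY CENTRAL INVOLUTION: `μ(G, c) = φ₂(G, c)`.**
Dispatch over a Sylow `2`-subgroup `P ∋ c`: abelian ⟹ part VII; an element of order `4` of `P` centralising `z` ⟹ an element of order `4pᵏ`,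
part XII; else the sheared datum of §2. [folklore] -/
theorem isLeast_card_gfaces_generate_fibreTwo_of_normal_zpowers_prime_pow (c : G) {p k : ℕ} (hp : p.Prime) (hp2 : p ≠ 2)
    (hk : 1 ≤ k) (hG : Fintype.card G = 8 * p ^ k) (z : G) (hz : orderOf z = p ^ k)
    (hzn : ∀ w : G, w * z * w⁻¹ ∈ Subgroup.zpowers z)
    (hc2 : c * c = 1) (hc1 : c ≠ 1) (hcen : ∀ w : G, w * c = c * w) :
    IsLeast {m : ℕ | ∃ S : Finset (CMF G c →₀ ℤ), (↑S ⊆ gfaceSet G c hc2) ∧ S.card = m ∧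
      hodgeSpan c hc2 ≤ Submodule.span ℤ (pairSet c) ⊔ Submodule.span ℤ (translates c S)} (fibreTwo c hc2) := by
  haveI : Fact (Nat.Prime 2) := ⟨Nat.prime_two⟩
  have hodd : Odd (p ^ k) := (hp.odd_of_ne_two hp2).pow
  have h3 : 3 ≤ p ^ k := by
    have h2 : 2 ≤ p := hp.two_le
    have : p ≤ p ^ k := Nat.le_self_pow (Nat.one_le_iff_ne_zero.mp hk) p
    omega
  have hcinv : c⁻¹ = c := inv_eq_of_mul_eq_one_right hc2
  obtain ⟨P⟩ := (Sylow.nonempty : Nonempty (Sylow 2 G))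
  obtain ⟨hP8, -⟩ := card_sylow_eq_eight P hG hodd
  have hcP : c ∈ (P : Subgroup G) := TypeStabiliser.mem_sylow_of_central c hc2 hcen P
  by_cases hcomm : ∀ a ∈ (P : Subgroup G), ∀ b ∈ (P : Subgroup G), a * b = b * a
  · exact isLeast_card_gfaces_generate_fibreTwo_of_card_eq_eight_mul_odd_comm c hG hodd (by omega) P hcomm hc2 hc1 hcen
  -- non-abelian: `y² = c`
  obtain ⟨y, hyP, hyy⟩ := exists_sq_of_card_eight_not_comm c hP8 hcomm hcP hc2 hc1 hcen
  have hy2 : y ^ 2 = c := by rw [pow_two, hyy]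
  have hordy : orderOf y = 4 := by
    have h := orderOf_eq_prime_pow (p := 2) (n := 1) (x := y) (by rw [pow_one, hy2]; exact hc1)
      (by rw [show 2 ^ (1 + 1) = 2 * 2 by norm_num, pow_mul, hy2, pow_two, hc2])
    simpa using h
  -- every element of `P` centralises or inverts `z`
  have hdichP : ∀ w ∈ (P : Subgroup G), w * z * w⁻¹ = z ∨ w * z * w⁻¹ = z⁻¹ := fun w hw => by
    refine conj_eq_or_eq_inv_of_sq_centralises hp hp2 hz (hzn w) ?_
    rcases sq_eq_one_or_eq_sq_of_card_eight_not_comm hP8 hcomm hyP hordy hw with h | h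
    · rw [h, inv_one, one_mul, mul_one]
    · rw [h, hy2, hcinv, ← hcen z, mul_assoc, hc2, mul_one]
  -- coprimality `4 ⊥ pᵏ`
  have hcop : Nat.Coprime 4 (p ^ k) := by
    rw [show (4 : ℕ) = 2 ^ 2 by norm_num]
    exact Nat.Coprime.pow_left _ (Nat.coprime_two_left.mpr hodd)
  rcases hdichP y hyP with hyz | hyz
  · -- `y` centralises `z`: `u = y z` has order `4pᵏ`
    have hc' : Commute y z := mul_inv_eq_iff_eq_mul.mp hyz
    have hordu : orderOf (y * z) = 4 * p ^ k := by
      rw [hc'.orderOf_mul_eq_mul_orderOf_of_coprime (by rw [hordy, hz]; exact hcop), hordy, hz]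
    exact isLeast_card_gfaces_generate_fibreTwo_of_card_eq_eight_mul_prime_pow c hp hp2 hk hG (y * z) hordu hc2 hc1 hcen
  · -- `y` inverts `z`; an element of `P ∖ ⟨y⟩` centralising `z`
    obtain ⟨x₀, hx₀P, hx₀⟩ := exists_notMem_zpowers_of_card_eight hP8 hordy
    obtain ⟨s, hsP, hsy', hsz⟩ : ∃ s ∈ (P : Subgroup G), s ∉ Subgroup.zpowers y ∧ s * z * s⁻¹ = z := by
      rcases hdichP x₀ hx₀P with h | h
      · exact ⟨x₀, hx₀P, hx₀, h⟩
      · refine ⟨x₀ * y, mul_mem hx₀P hyP, fun hmem => hx₀ ?_, ?_⟩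
        · have : x₀ = x₀ * y * y⁻¹ := by rw [mul_inv_cancel_right]
          rw [this]
          exact mul_mem hmem (inv_mem (Subgroup.mem_zpowers y))
        · calc x₀ * y * z * (x₀ * y)⁻¹ = x₀ * (y * z * y⁻¹) * x₀⁻¹ := by group
            _ = x₀ * z⁻¹ * x₀⁻¹ := by rw [hyz]
            _ = (x₀ * z * x₀⁻¹)⁻¹ := by group
            _ = z := by rw [h, inv_inv]
    obtain ⟨hsy, hs2⟩ := conj_eq_inv_and_sq_of_card_eight_not_comm hP8 hcomm hyP hsP hordy hsy'
    rcases hs2 with hs2 | hs2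
    · -- `s` is an involution: the sheared datum
      exact isLeast_card_gfaces_generate_fibreTwo_of_sheared_elements c hodd h3 hG z y s hz hyy hyz hs2
        (mul_inv_eq_iff_eq_mul.mp hsz) hsy hc2 hc1 hcen
    · -- `s` has order `4` and centralises `z`: `u = s z` has order `4pᵏ`
      rw [hy2] at hs2
      have hords : orderOf s = 4 := by
        have h := orderOf_eq_prime_pow (p := 2) (n := 1) (x := s) (by rw [pow_one, pow_two, hs2]; exact hc1)
          (by rw [show 2 ^ (1 + 1) = 2 * 2 by norm_num, pow_mul, pow_two s, hs2, pow_two, hc2])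
        simpa using h
      have hc' : Commute s z := mul_inv_eq_iff_eq_mul.mp hsz
      have hordu : orderOf (s * z) = 4 * p ^ k := by
        rw [hc'.orderOf_mul_eq_mul_orderOf_of_coprime (by rw [hords, hz]; exact hcop), hords, hz]
      exact isLeast_card_gfaces_generate_fibreTwo_of_card_eq_eight_mul_prime_pow c hp hp2 hk hG (s * z) hordu hc2 hc1 hcen

/-- **ORDER `8p` (`p` an odd prime) WITH A NORMAL SUBGROUP `⟨z⟩` OF ORDER `p`, EVERY CENTRAL INVOLUTION: `μ(G, c) = φ₂(G, c)`.** [folklore] -/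
theorem isLeast_card_gfaces_generate_fibreTwo_of_normal_zpowers_prime (c : G) {p : ℕ} (hp : p.Prime) (hp2 : p ≠ 2)
    (hG : Fintype.card G = 8 * p) (z : G) (hz : orderOf z = p) (hzn : ∀ w : G, w * z * w⁻¹ ∈ Subgroup.zpowers z)
    (hc2 : c * c = 1) (hc1 : c ≠ 1) (hcen : ∀ w : G, w * c = c * w) :
    IsLeast {m : ℕ | ∃ S : Finset (CMF G c →₀ ℤ), (↑S ⊆ gfaceSet G c hc2) ∧ S.card = m ∧
      hodgeSpan c hc2 ≤ Submodule.span ℤ (pairSet c) ⊔ Submodule.span ℤ (translates c S)} (fibreTwo c hc2) :=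
  isLeast_card_gfaces_generate_fibreTwo_of_normal_zpowers_prime_pow c hp hp2 (k := 1) le_rfl (by rw [pow_one, hG]) z
    (by rw [pow_one, hz]) hzn hc2 hc1 hcen

/-- **ORDER `24` WITH A NORMAL SUBGROUP OF ORDER `3`, EVERY CENTRAL INVOLUTION: `μ(G, c) = φ₂(G, c)`** — every group of order `24` with a
central involution except `SL(2,3)` (`β = 176`, `φ₂ = 174`, open). [folklore] -/
theorem isLeast_card_gfaces_generate_fibreTwo_of_card_eq_twentyfour_of_normal (c : G) (hG : Fintype.card G = 24) (z : G)
    (hz : orderOf z = 3) (hzn : ∀ w : G, w * z * w⁻¹ ∈ Subgroup.zpowers z)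
    (hc2 : c * c = 1) (hc1 : c ≠ 1) (hcen : ∀ w : G, w * c = c * w) :
    IsLeast {m : ℕ | ∃ S : Finset (CMF G c →₀ ℤ), (↑S ⊆ gfaceSet G c hc2) ∧ S.card = m ∧
      hodgeSpan c hc2 ≤ Submodule.span ℤ (pairSet c) ⊔ Submodule.span ℤ (translates c S)} (fibreTwo c hc2) :=
  isLeast_card_gfaces_generate_fibreTwo_of_normal_zpowers_prime c Nat.prime_three (by norm_num) (by rw [hG]) z hz hzn hc2 hc1 hcen

end

end Summit.HodgeConjecture.CorCM.Census.SylowTransfer
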